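import Summits.CriticalPhenomena.PercolationContinuityZ3.Theorems.PercNearOneGluingNoHeavyLowerTailMajorityGluingQCertSymParts
import HarnessLib

/-!
# Part 9 of 18 of the orbit certificate of the cell `(12,7)` at `c = 157/100`: data and digest (lane prim-rate, constants-miner 1, gen 36; generated by cert/mksym.py)

Support file for the closed crux `NoHeavyLowerTail` (stmt-CriticalPhenomena-4575), majority-gluing line.  The symmetrised certificate of the cell `(12,7)`
(kit j286395, symcert.py) is checked IN PARTS (`…MajorityGluingQCertSymParts`): this file holds part 9 (1 multiplier terms, 1 marginal slacks,
0 rows, 0 squares; 3636 contributions) and its DIGEST `twelveSevenSymP9D` (44 orbit keys), verified by `decide +kernel` (`twelveSevenSymP9_digest`).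
The parts are glued in `…MajorityGluingQCertSymTwelveSeven`.  No sorries. [cite: VandenbergKahn2001, Thm 1.2 (p. 123)]
-/

namespace Summit.CriticalPhenomena.PercolationContinuityZ3.Theorems

namespace HubOnly
namespace QCert

/-- Row representatives of part 9: `(A, X, B, Y, n, masks of f(A,X), f(B,Y), f(A∪B,X∩Y), f(∅,X∪Y))`. -/
def twelveSevenSymP9Rows : List RowE :=
  []

/-- Square representatives of part 9: `(a, b, n, mask₁, mask₂)`. -/
def twelveSevenSymP9Sqs : List SqE :=
  []

/-- **Part 9** of the `(12,7)` orbit certificate at `157/100`. -/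
def twelveSevenSymP9 : SymCert :=
  ⟨⟨12, 7, 157, 100, 1, [], [], []⟩,
    [(4096, 1000000000000000)],
    [(0, 15, 1356115841095568640)],
    [twelveSevenSymP9Rows], [twelveSevenSymP9Sqs]⟩

/-- The digest of part 9: `(orbit key, coefficient total)` in increasing key order (computed by cert/mksym.py, verified below). -/
def twelveSevenSymP9D : List (ℕ × ℤ) :=
  [((4112 : ℕ), (1356115841095568640 : ℤ)), (12306, 4068347523286705920), (12320, 10848926728764549120), (28694, 4068347523286705920), 
    (28706, 32546780186293647360), (28736, 37971243550675921920), (61470, 1356115841095568640), (61478, 32546780186293647360), 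
    (61486, 10848926728764549120), (61506, 113913730652027765760), (61510, 113913730652027765760), (61518, 37971243550675921920), 
    (61568, 75942487101351843840), (61570, 227827461304055531520), (61574, 227827461304055531520), (61582, 75942487101351843840), 
    (61696, 94928108876689804800), (61698, 284784326630069414400), (61702, 284784326630069414400), (61710, 94928108876689804800), 
    (61952, 75942487101351843840), (61954, 227827461304055531520), (61958, 227827461304055531520), (61966, 75942487101351843840), 
    (62464, 37971243550675921920), (62466, 113913730652027765760), (62470, 113913730652027765760), (62478, 37971243550675921920), 
    (63488, 10848926728764549120), (63490, 32546780186293647360), (63494, 32546780186293647360), (63502, 10848926728764549120), 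
    (65536, 1356115841095568640), (65538, 4068347523286705920), (65542, 4068347523286705920), (65550, 1356115841095568640), 
    (16781327, -1356115841095568640), (16781439, -79200000000000000000), (16781567, -49500000000000000000), (16781823, -22000000000000000000), 
    (16782335, -6600000000000000000), (16783359, -1200000000000000000), (16785407, -100000000000000000), (16785408, 157000000000000000)]

/-- **The digest of part 9 is `twelveSevenSymP9D`** (kernel evaluation of the part's 3636 contributions). -/
theorem twelveSevenSymP9_digest : twelveSevenSymP9.digest 20 = twelveSevenSymP9D := by
  decide +kernel

end QCert
end HubOnly

end Summit.CriticalPhenomena.PercolationContinuityZ3.Theorems
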